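import Summits.BirchSwinnertonDyer.Rank1Residual.F1Sign2.ParitySymbolCocycleAtTwoProofsHalving

/-!
# Cell `bsd-f1-sign2`, lens `-desc` g14 (MEMO-desc §22.13-add3): row DESC-§22-H `KummerHalvingCriterionAtTwo` — CASSELS' LEMMA for EVERY rational point
# of the Green–Maistret partner `E′_f = gmPartner a b c`, TYPED AND PROVED (`kummerHalvingCriterionAtTwo_holds`)

SIBLING MODULE (-ty g8): the §22 statement module `F1Sign2/ParitySymbolCocycleAtTwo.lean` is at 392/400 lines, so this PROVED support row gets its own file:
the row `KummerHalvingCriterionAtTwo` (plain `def … : Prop`, ns `Summit.BirchSwinnertonDyer.Rank1Residual.F1Sign2`, body VERBATIM from the planner's file) together with its kernel proof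
(planner -desc g14 `HOME/MEMO-desc-data/g14/lean/KummerHalving.lean` 2565c38e957fa1e0, 207 l., lines 29–195 VERBATIM in the planner's sub-namespace
`…F1Sign2.MarkedPoint`: `isSquare_kummer_of_halves`, `exists_halves_of_isSquare_kummer`, `halves_iff_isSquare_kummer`; farm rc 0 · 0 warn · 0 sorry, axioms
propext, Classical.choice, Quot.sound) and `Summit.BirchSwinnertonDyer.Rank1Residual.F1Sign2.kummerHalvingCriterionAtTwo_holds` closing the row BY NAME (the planner's local copy of the def is
replaced by the tree-namespace one; nothing else changed).  Imports the landed part 4 `…ProofsHalving.lean` (p623774) for `MarkedPoint.coords_eq_zero`,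
`exists_coords`, `equation_gmPartner`, `negY_gmPartner`.  Rows V/V′ (p623106, proved p623774/p623562) are the marked-point case `P = (0,c)` of this row
composed with row U.  No `sorry`, no `instance`, no `notation`, no Literature fact.

TYPER FILING (seat `bsd-f1-sign2-ty` g8; CANDIDATES.md row DESC-§22-H; -desc CANDIDATES-delta ADDENDUM 7 2026-08-28T10:09:43Z): builder `tools/mk_desc22h.py`
(sha-asserting; published with the filed text under `HOME/MEMO-ty-data/g8/`).
REF1-AUDIT §92 (g9, D-desc-ref1-24, 2026-08-28T10:24:02Z): SURVIVES, PROVED (axioms trio), CLEARED — faithful to Cassels §15 Lemma 2 pointwise (θ_W = 4e, `4x_P − θ = 4·(x − e)`, same square class); scope WIDER than print in three harmless directions covered by the kernel proof (a₂ ≠ 0; reducible cubic with `IsSquare` in the ring replacing Cassels' patch at 2-torsion points; singular cubics, e3); H = H′|_{gmPartner} definitionally (e1; r2: one row suffices); H at T₀ = the tree's parts-3/4 criterion (e2/e2′); both sides co-inhabited in the kernel (e4: on (a,b,c) = (2,5,1), Q = (−2,−3) halves T₀ = (0,1)); certificate p624323 ← KummerHalving.lean 5 SAME / 0 DIFF;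 riders (text, optional): r1 «explicit half = Cassels' own proof of Lemma 15.2 made explicit (p₂ ≠ 0 + linear condition)», r3 `a₁ = a₃ = 0` is a normal form (criterion true for every W/ℚ by completing the square), r4 `IsSquare` in the ring = Cassels' patch.
REF2-PLACEMENT v24 §1 (45974357b6e499b5, D-desc-ref2-24, 2026-08-28T10:27:23Z): KNOWN — Cassels 1991 LMSST §15 Lemma 2 [corpus:book:cassels1991-lmsst-lectures-elliptic-curves p0042–p0043] (étale-algebra form: Schaefer–Stoll); formalisation; beyond-print no; PARTITION none.
PARTITION: none; beyond-print theorem: no (KNOWN lemma, kernel proof; BSD is not proved by any of this).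

Planner's proof-file docstring (verbatim, -desc g14 `KummerHalving.lean`):
# Cell `bsd-f1-sign2`, lens `-desc` g14 (MEMO-desc §22.13-add3): row DESC-§22-H `KummerHalvingCriterionAtTwo` —
# CASSELS' LEMMA for EVERY rational point of the Green–Maistret partner `E′_f = gmPartner a b c : y² = x³ + bx² + acx + c²`.

TREE-COMPATIBLE DRAFT (imports the landed `F1Sign2.ParitySymbolCocycleAtTwoProofsHalving`, p623774, for `MarkedPoint.coords_eq_zero`,
`exists_coords`, `equation_gmPartner`, `negY_gmPartner`): the two arguments of rows V/V′ run for an ARBITRARY `P = (x_P, y_P) ∈ E′_f(ℚ)` —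
* `isSquare_kummer_of_halves` — `Q + Q = P ⇒ 4x_P − θ′ = (M/(16y_Q))²` in `L_{E′} = ℚ[T]/(c_{E′})`, `M = (4x_Q − θ′)² − (3θ′² + 8bθ′ + 16ac)`
  (one `linear_combination`; certificate `256P₃² − 256g(x_Q)(4b + 8x_Q + θ′) − M² = −4(θ′ + 8x_Q + 4b)c_{E′}(θ′)` with `P₃² = 4y_Q²(x_P + b + 2x_Q)`);
* `exists_halves_of_isSquare_kummer` — `4x_P − θ′ = (α₀ + α₁θ′ + α₂θ′²)² ⇒ α₂ ≠ 0` and `Q := (α₁/(4α₂) − b, −1/(8α₂))` has `2Q = ±P`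
  (the `θ′²`-coefficient of `M(x_Q)² = (16y_Q(α + r))²` kills the defect `r`, the `θ′`-coefficient is the Weierstrass equation, the constant is `x(2Q) = x_P`;
  then `y(2Q)² = y_P²`);
* `halves_iff_isSquare_kummer`, and **row H** `kummerHalvingCriterionAtTwo_holds : KummerHalvingCriterionAtTwo`.
NO hypothesis on `a b c`: the cubic `c_{E′}` may be reducible (`L_{E′}` a product of fields) and `E′_f` may even be singular (Mathlib's `Point` = nonsingular
points) — the statement and proof are uniform. In print (fields case): Cassels, LMSST 24 (1991) §15 Lemma 2 «the kernel of μ is 2𝔊» [cite: Cassels1991, §15 Lemma 2];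
the explicit half and the product-of-fields uniformity are this file's. No `sorry`, no `instance`, no `notation`; axioms propext / Classical.choice / Quot.sound.
-/

noncomputable section

open scoped Classical

open WeierstrassCurve Polynomial

namespace Summit.BirchSwinnertonDyer.Rank1Residual.F1Sign2

/-- DESC-§22-H (support, KNOWN in print as Cassels' lemma `E(ℚ)/2E(ℚ) ↪ L^×/L^{×2}`, `P ↦ x_P − e`; here for the
Green–Maistret partner family and WITHOUT any hypothesis on the cubic — `L_{E′} = ℚ[T]/(c_{E′})` may be a product of fields):
for every `P = (x_P, y_P) ∈ E′_f(ℚ)`, `P ∈ 2E′_f(ℚ) ⟺ 4x_P − θ′ ∈ L_{E′}^{2}`.  PROVED below (`kummerHalvingCriterionAtTwo_holds`).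
REF1-AUDIT §92 (g9, D-desc-ref1-24, 2026-08-28T10:24:02Z): SURVIVES, PROVED (axioms trio), CLEARED — faithful to Cassels §15 Lemma 2 pointwise (θ_W = 4e, `4x_P − θ = 4·(x − e)`, same square class); scope WIDER than print in three harmless directions covered by the kernel proof (a₂ ≠ 0; reducible cubic with `IsSquare` in the ring replacing Cassels' patch at 2-torsion points; singular cubics, e3); H = H′|_{gmPartner} definitionally (e1; r2: one row suffices); H at T₀ = the tree's parts-3/4 criterion (e2/e2′); both sides co-inhabited in the kernel (e4: on (a,b,c) = (2,5,1), Q = (−2,−3) halves T₀ = (0,1)); certificate p624323 ← KummerHalving.lean 5 SAME / 0 DIFF; riders (text, optional): r1 «explicit half = Cassels' own proof of Lemma 15.2 made explicit (p₂ ≠ 0 + linear condition)», r3 `a₁ = a₃ = 0` is a normal form (criterion true for every W/ℚ by completing the square), r4 `IsSquare` in the ring = Cassels' patch.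
REF2-PLACEMENT v24 §1 (45974357b6e499b5, D-desc-ref2-24, 2026-08-28T10:27:23Z): KNOWN — Cassels 1991 LMSST §15 Lemma 2 [corpus:book:cassels1991-lmsst-lectures-elliptic-curves p0042–p0043] (étale-algebra form: Schaefer–Stoll); formalisation; beyond-print no; PARTITION none.
[cite: Cassels1991, §15 Lemma 2] -/
def KummerHalvingCriterionAtTwo : Prop :=
  ∀ (a b c : ℤ) (xP yP : ℚ) (hP : (gmPartner a b c).toAffine.Nonsingular xP yP),
    (∃ Q : (gmPartner a b c).toAffine.Point, Q + Q = WeierstrassCurve.Affine.Point.some xP yP hP) ↔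
      IsSquare (algebraMap ℚ (twoDivisionAlgebra (gmPartner a b c)) (4 * xP) - twoDivisionRoot (gmPartner a b c))

end Summit.BirchSwinnertonDyer.Rank1Residual.F1Sign2

namespace Summit.BirchSwinnertonDyer.Rank1Residual.F1Sign2.MarkedPoint

/-! ## Cassels' lemma for an arbitrary rational point of `E′_f` (the Kummer class `4x_P − θ′`) -/

/-- KUMMER MAP, halving direction: if `Q + Q = P = (x_P, y_P)` in `E′_f(ℚ)` then `4x_P − θ′` is a square in `L_{E′}`
(`4x(2Q) − θ′ = (M/(16y_Q))²`, `M = (4x_Q − θ′)² − (3θ′² + 8bθ′ + 16ac)`). -/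
theorem isSquare_kummer_of_halves (a b c : ℤ) {xP yP : ℚ} (hP : (gmPartner a b c).toAffine.Nonsingular xP yP)
    (Q : (gmPartner a b c).toAffine.Point) (hQ : Q + Q = WeierstrassCurve.Affine.Point.some xP yP hP) :
    IsSquare (algebraMap ℚ (twoDivisionAlgebra (gmPartner a b c)) (4 * xP) - twoDivisionRoot (gmPartner a b c)) := by
  rcases Q with _ | ⟨x₀, y₀, hQ0⟩
  · simp only [← WeierstrassCurve.Affine.Point.zero_def, add_zero] at hQ
    exact absurd hQ.symm (WeierstrassCurve.Affine.Point.some_ne_zero _)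
  · by_cases hy : y₀ = (gmPartner a b c).toAffine.negY x₀ y₀
    · rw [WeierstrassCurve.Affine.Point.add_self_of_Y_eq hy] at hQ
      exact absurd hQ.symm (WeierstrassCurve.Affine.Point.some_ne_zero _)
    · rw [WeierstrassCurve.Affine.Point.add_self_of_Y_ne hy] at hQ
      have hx : (gmPartner a b c).toAffine.addX x₀ x₀ ((gmPartner a b c).toAffine.slope x₀ x₀ y₀ y₀) = xP :=
        (WeierstrassCurve.Affine.Point.some.injEq _ _ _ _ _ _).mp hQ |>.1
      rw [WeierstrassCurve.Affine.slope_of_Y_ne rfl hy] at hx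
      have hy0 : y₀ ≠ 0 := by
        intro h0; apply hy; rw [negY_gmPartner, h0, neg_zero]
      have heq := equation_gmPartner a b c hQ0.1
      simp only [negY_gmPartner, WeierstrassCurve.Affine.addX] at hx
      simp [gmPartner] at hx
      have h2y : (y₀ - -y₀) ≠ 0 := by
        intro h0; apply hy0; linarith
      have hx1 : (3 * x₀ ^ 2 + 2 * (b : ℚ) * x₀ + (a : ℚ) * c) ^ 2 = 4 * y₀ ^ 2 * (xP + (b : ℚ) + 2 * x₀) := by
        field_simp at hx
        linear_combination hx
      have hF := GluedPairIdentity.root_relation (gmPartner a b c)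
      rw [gmP_b₂, gmP_b₄, gmP_b₆] at hF
      have h16y : (16 * y₀) ≠ 0 := mul_ne_zero (by norm_num) hy0
      have hW0 := congrArg (algebraMap ℚ (twoDivisionAlgebra (gmPartner a b c))) (mul_inv_cancel₀ h16y)
      have heq' := congrArg (algebraMap ℚ (twoDivisionAlgebra (gmPartner a b c))) heq
      have hx1' := congrArg (algebraMap ℚ (twoDivisionAlgebra (gmPartner a b c))) hx1
      simp only [map_mul, map_ofNat, map_pow, map_add, map_one] at hF hW0 heq' hx1'
      refine ⟨algebraMap ℚ (twoDivisionAlgebra (gmPartner a b c)) ((16 * y₀)⁻¹) *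
        ((algebraMap ℚ (twoDivisionAlgebra (gmPartner a b c)) (4 * x₀) - twoDivisionRoot (gmPartner a b c)) ^ 2 -
          (3 * twoDivisionRoot (gmPartner a b c) ^ 2 + algebraMap ℚ (twoDivisionAlgebra (gmPartner a b c)) (8 * (b : ℚ)) * twoDivisionRoot (gmPartner a b c) +
            algebraMap ℚ (twoDivisionAlgebra (gmPartner a b c)) (16 * ((a : ℚ) * c)))), ?_⟩
      simp only [map_mul, map_ofNat]
      generalize twoDivisionRoot (gmPartner a b c) = t at hF ⊢
      generalize algebraMap ℚ (twoDivisionAlgebra (gmPartner a b c)) ((16 * y₀)⁻¹) = Wc at hW0 ⊢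
      generalize algebraMap ℚ (twoDivisionAlgebra (gmPartner a b c)) x₀ = X at heq' hx1' ⊢
      generalize algebraMap ℚ (twoDivisionAlgebra (gmPartner a b c)) xP = XP at hx1' ⊢
      generalize algebraMap ℚ (twoDivisionAlgebra (gmPartner a b c)) y₀ = Y at heq' hx1' hW0 ⊢
      generalize algebraMap ℚ (twoDivisionAlgebra (gmPartner a b c)) (a : ℚ) = A at hF heq' hx1' ⊢
      generalize algebraMap ℚ (twoDivisionAlgebra (gmPartner a b c)) (b : ℚ) = B at hF heq' hx1' ⊢
      generalize algebraMap ℚ (twoDivisionAlgebra (gmPartner a b c)) (c : ℚ) = Cc at hF heq' hx1' ⊢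
      linear_combination (-(256 * Wc ^ 2)) * hx1' + (-(256 * Wc ^ 2 * (4 * B + 8 * X + t))) * heq' +
        (-(4 * Wc ^ 2 * (t + 8 * X + 4 * B))) * hF + (-((4 * XP - t) * (16 * Y * Wc + 1))) * hW0

/-- **CASSELS' LEMMA for `E′_f`** (the `2`-division cubic need not split): for `P = (x_P, y_P) ∈ E′_f(ℚ)`,
`4x_P − θ′ ∈ L_{E′}^{×2} ⇒ P ∈ 2E′_f(ℚ)`, with the explicit half `Q = (α₁/(4α₂) − b, −1/(8α₂))` for `4x_P − θ′ = (α₀ + α₁θ′ + α₂θ′²)²`. -/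
theorem exists_halves_of_isSquare_kummer (a b c : ℤ) {xP yP : ℚ} (hP : (gmPartner a b c).toAffine.Nonsingular xP yP)
    (hsq : IsSquare (algebraMap ℚ (twoDivisionAlgebra (gmPartner a b c)) (4 * xP) - twoDivisionRoot (gmPartner a b c))) :
    ∃ Q : (gmPartner a b c).toAffine.Point, Q + Q = WeierstrassCurve.Affine.Point.some xP yP hP := by
  obtain ⟨v, hv⟩ := hsq
  obtain ⟨α₀, α₁, α₂, hvexp⟩ := exists_coords a b c v
  have hF := GluedPairIdentity.root_relation (gmPartner a b c)
  rw [gmP_b₂, gmP_b₄, gmP_b₆] at hF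
  simp only [map_mul, map_ofNat, map_pow] at hF
  have hPeq := equation_gmPartner a b c hP.1
  -- (1) α₂ ≠ 0
  have hα₂ : α₂ ≠ 0 := by
    intro h0
    have hA2 : algebraMap ℚ (twoDivisionAlgebra (gmPartner a b c)) α₂ = 0 := by rw [h0, map_zero]
    have key : algebraMap ℚ (twoDivisionAlgebra (gmPartner a b c)) (α₀ ^ 2 - 4 * xP) + algebraMap ℚ (twoDivisionAlgebra (gmPartner a b c)) (2 * α₀ * α₁ + 1) * twoDivisionRoot (gmPartner a b c) +
        algebraMap ℚ (twoDivisionAlgebra (gmPartner a b c)) (α₁ ^ 2) * twoDivisionRoot (gmPartner a b c) ^ 2 = 0 := by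
      simp only [map_add, map_sub, map_mul, map_pow, map_one, map_ofNat] at hv ⊢
      generalize twoDivisionRoot (gmPartner a b c) = t at hv hvexp ⊢
      generalize algebraMap ℚ (twoDivisionAlgebra (gmPartner a b c)) α₀ = A0 at hvexp ⊢
      generalize algebraMap ℚ (twoDivisionAlgebra (gmPartner a b c)) α₁ = A1 at hvexp ⊢
      generalize algebraMap ℚ (twoDivisionAlgebra (gmPartner a b c)) α₂ = A2 at hvexp hA2 ⊢
      generalize algebraMap ℚ (twoDivisionAlgebra (gmPartner a b c)) xP = XP at hv ⊢
      linear_combination (-1 : (twoDivisionAlgebra (gmPartner a b c))) * hv + (-(v + (A0 + A1 * t + A2 * t ^ 2))) * hvexp +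
        (-(t ^ 2 * (2 * A0 + 2 * A1 * t + A2 * t ^ 2))) * hA2
    obtain ⟨-, h1, h2⟩ := coords_eq_zero a b c _ _ _ key
    have : α₁ = 0 := pow_eq_zero_iff (two_ne_zero) |>.mp h2
    rw [this] at h1
    norm_num at h1
  -- (2) the half `Q = (x₀, y₀)` and the defect `r`
  obtain ⟨y₀, hy⟩ : ∃ y₀ : ℚ, 8 * α₂ * y₀ = -1 :=
    ⟨-(8 * α₂)⁻¹, by rw [mul_neg, mul_inv_cancel₀ (mul_ne_zero (by norm_num) hα₂)]⟩
  have hy0 : y₀ ≠ 0 := by rintro rfl; norm_num at hy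
  obtain ⟨x₀, hx⟩ : ∃ x₀ : ℚ, 4 * α₂ * (x₀ + b) = α₁ :=
    ⟨α₁ / (4 * α₂) - b, by rw [sub_add_cancel, mul_div_cancel₀ _ (mul_ne_zero (by norm_num) hα₂)]⟩
  obtain ⟨r, hr⟩ : ∃ r : ℚ, r * y₀ = x₀ ^ 2 - a * c - α₀ * y₀ :=
    ⟨(x₀ ^ 2 - a * c - α₀ * y₀) / y₀, div_mul_cancel₀ _ hy0⟩
  have hy' := congrArg (algebraMap ℚ (twoDivisionAlgebra (gmPartner a b c))) hy
  have hx' := congrArg (algebraMap ℚ (twoDivisionAlgebra (gmPartner a b c))) hx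
  have hr' := congrArg (algebraMap ℚ (twoDivisionAlgebra (gmPartner a b c))) hr
  simp only [map_mul, map_ofNat, map_neg, map_one, map_add, map_sub, map_pow] at hy' hx' hr'
  -- (3) the coefficient equation in L′
  have hK : algebraMap ℚ (twoDivisionAlgebra (gmPartner a b c)) (256 * y₀ ^ 2 * r ^ 2 + 512 * y₀ ^ 2 * r * α₀ + 1024 * y₀ ^ 2 * xP -
        256 * (3 * x₀ ^ 2 + 2 * b * x₀ + a * c) ^ 2 + 256 * (x₀ ^ 3 + b * x₀ ^ 2 + a * c * x₀ + (c : ℚ) ^ 2) * (4 * b + 8 * x₀)) +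
      algebraMap ℚ (twoDivisionAlgebra (gmPartner a b c)) (-256 * y₀ ^ 2 + 512 * y₀ ^ 2 * r * α₁ + 256 * (x₀ ^ 3 + b * x₀ ^ 2 + a * c * x₀ + (c : ℚ) ^ 2)) *
        twoDivisionRoot (gmPartner a b c) +
      algebraMap ℚ (twoDivisionAlgebra (gmPartner a b c)) (512 * y₀ ^ 2 * r * α₂) * twoDivisionRoot (gmPartner a b c) ^ 2 = 0 := by
    simp only [map_mul, map_ofNat, map_neg, map_add, map_sub, map_pow] at hv ⊢
    generalize twoDivisionRoot (gmPartner a b c) = t at hF hv hvexp ⊢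
    generalize algebraMap ℚ (twoDivisionAlgebra (gmPartner a b c)) x₀ = X0 at hx' hr' ⊢
    generalize algebraMap ℚ (twoDivisionAlgebra (gmPartner a b c)) xP = XP at hv ⊢
    generalize algebraMap ℚ (twoDivisionAlgebra (gmPartner a b c)) y₀ = Y0 at hy' hr' ⊢
    generalize algebraMap ℚ (twoDivisionAlgebra (gmPartner a b c)) r = Rr at hr' ⊢
    generalize algebraMap ℚ (twoDivisionAlgebra (gmPartner a b c)) α₀ = A0 at hvexp hr' ⊢
    generalize algebraMap ℚ (twoDivisionAlgebra (gmPartner a b c)) α₁ = A1 at hvexp hx' ⊢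
    generalize algebraMap ℚ (twoDivisionAlgebra (gmPartner a b c)) α₂ = A2 at hvexp hy' hx' ⊢
    generalize algebraMap ℚ (twoDivisionAlgebra (gmPartner a b c)) (a : ℚ) = A at hF hr' ⊢
    generalize algebraMap ℚ (twoDivisionAlgebra (gmPartner a b c)) (b : ℚ) = B at hF hx' ⊢
    generalize algebraMap ℚ (twoDivisionAlgebra (gmPartner a b c)) (c : ℚ) = Cc at hF hr' ⊢
    have hMi : (4 * X0 - t) ^ 2 - (3 * t ^ 2 + 8 * B * t + 16 * (A * Cc)) = 16 * Y0 * (v + Rr) := by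
      linear_combination (-(16 * Y0)) * hvexp + (-(2 * t ^ 2) - 8 * (X0 + B) * t) * hy' + (16 * Y0 * t) * hx' +
        (-16 : (twoDivisionAlgebra (gmPartner a b c))) * hr'
    linear_combination (256 * Y0 ^ 2) * hv + (-(512 * Y0 ^ 2 * Rr)) * hvexp +
      (-(16 * Y0 * (v + Rr) + ((4 * X0 - t) ^ 2 - (3 * t ^ 2 + 8 * B * t + 16 * (A * Cc))))) * hMi +
      (4 * (t + 8 * X0 + 4 * B)) * hF
  obtain ⟨hk0, hk1, hk2⟩ := coords_eq_zero a b c _ _ _ hK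
  -- (4) read off: r = 0, the curve equation, x(2Q) = x_P
  have hr0 : r = 0 := by
    by_contra hne
    exact (mul_ne_zero (mul_ne_zero (mul_ne_zero (by norm_num) (pow_ne_zero 2 hy0)) hne) hα₂) hk2
  rw [hr0] at hk0 hk1
  have heq : y₀ ^ 2 = x₀ ^ 3 + b * x₀ ^ 2 + a * c * x₀ + (c : ℚ) ^ 2 := by
    linear_combination (-1 / 256 : ℚ) * hk1
  have hdup : (3 * x₀ ^ 2 + 2 * b * x₀ + a * c) ^ 2 = 4 * y₀ ^ 2 * (xP + (b : ℚ) + 2 * x₀) := by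
    linear_combination (-1 / 256 : ℚ) * hk0 + (-(4 * b + 8 * x₀)) * heq
  -- (5) the point Q = (x₀, y₀)
  have hQns : (gmPartner a b c).toAffine.Nonsingular x₀ y₀ := by
    rw [WeierstrassCurve.Affine.nonsingular_iff']
    refine ⟨?_, Or.inr ?_⟩
    · rw [WeierstrassCurve.Affine.equation_iff']
      simp [gmPartner]
      linear_combination heq
    · simp [gmPartner]
      intro h0; apply hy0; linarith
  have hyne : y₀ ≠ (gmPartner a b c).toAffine.negY x₀ y₀ := by
    rw [negY_gmPartner]; intro h0; apply hy0; linarith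
  obtain ⟨X2, Y2, H2, hQQ, hX2⟩ : ∃ (X2 Y2 : ℚ) (H2 : (gmPartner a b c).toAffine.Nonsingular X2 Y2),
      WeierstrassCurve.Affine.Point.some x₀ y₀ hQns + WeierstrassCurve.Affine.Point.some x₀ y₀ hQns =
        WeierstrassCurve.Affine.Point.some X2 Y2 H2 ∧ X2 = xP := by
    refine ⟨_, _, _, WeierstrassCurve.Affine.Point.add_self_of_Y_ne hyne, ?_⟩
    rw [WeierstrassCurve.Affine.slope_of_Y_ne rfl hyne]
    simp only [negY_gmPartner, WeierstrassCurve.Affine.addX]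
    simp [gmPartner]
    have h2y : (y₀ - -y₀) ≠ 0 := by intro h0; apply hy0; linarith
    field_simp
    linear_combination hdup
  have hY2 : Y2 ^ 2 = yP ^ 2 := by
    have := equation_gmPartner a b c H2.1
    rw [hX2] at this
    linear_combination this - hPeq
  have key : ∀ {x y : ℚ} {hxy : (gmPartner a b c).toAffine.Nonsingular x y}, x = xP → y = yP →
      WeierstrassCurve.Affine.Point.some x y hxy = WeierstrassCurve.Affine.Point.some xP yP hP := by
    rintro x y hxy rfl rfl; rfl
  rcases sq_eq_sq_iff_eq_or_eq_neg.mp hY2 with hc1 | hc2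
  · exact ⟨WeierstrassCurve.Affine.Point.some x₀ y₀ hQns, hQQ.trans (key hX2 hc1)⟩
  · refine ⟨-WeierstrassCurve.Affine.Point.some x₀ y₀ hQns, ?_⟩
    rw [← neg_add, hQQ, WeierstrassCurve.Affine.Point.neg_some]
    apply key hX2
    rw [negY_gmPartner, hc2, neg_neg]

/-- **Cassels' lemma for `E′_f`, both directions**: `P ∈ 2E′_f(ℚ) ⟺ 4x_P − θ′ ∈ L_{E′}^{×2}` (no assumption on `c_{E′}` beyond being the cubic of `E′_f`). -/
theorem halves_iff_isSquare_kummer (a b c : ℤ) {xP yP : ℚ} (hP : (gmPartner a b c).toAffine.Nonsingular xP yP) :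
    (∃ Q : (gmPartner a b c).toAffine.Point, Q + Q = WeierstrassCurve.Affine.Point.some xP yP hP) ↔
      IsSquare (algebraMap ℚ (twoDivisionAlgebra (gmPartner a b c)) (4 * xP) - twoDivisionRoot (gmPartner a b c)) :=
  ⟨fun ⟨Q, hQ⟩ => isSquare_kummer_of_halves a b c hP Q hQ, exists_halves_of_isSquare_kummer a b c hP⟩

end Summit.BirchSwinnertonDyer.Rank1Residual.F1Sign2.MarkedPoint

namespace Summit.BirchSwinnertonDyer.Rank1Residual.F1Sign2

/-- **DESC-§22-H `KummerHalvingCriterionAtTwo` HOLDS** (Cassels' lemma for `E′_f`, both directions, no hypothesis on the cubic; proof -desc g14). -/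
theorem kummerHalvingCriterionAtTwo_holds : KummerHalvingCriterionAtTwo :=
  fun a b c _ _ hP => MarkedPoint.halves_iff_isSquare_kummer a b c hP

end Summit.BirchSwinnertonDyer.Rank1Residual.F1Sign2

end
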